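import Literature.MathematicalPhysics.QuantumFieldTheory.CurvatureGaussianField
import Mathlib.Analysis.Calculus.ParametricIntegral
import Mathlib.Analysis.Calculus.MeanValue
import Mathlib.Analysis.SpecialFunctions.ExpDeriv
import Mathlib.Analysis.SpecialFunctions.Trigonometric.Deriv
import HarnessLib

/-!
# Stub `stub_steinFlow` of line `Sketch` (crux `stmt-QuantumFields-8760`)

Route `EquipartitionCriticality` of `YangMills`, crux item `stmt-QuantumFields-8760`
(`Summit.QuantumFields.YangMills.Theses.EquipartitionCriticality.EquipartitionPinsProbe`), line
`Sketch`, STUB R1 ("Stein flow") of the lead's skeleton.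

What is proved: let `τ` be a probability measure on `ℝ^D`-valued `2`-cochains
`Y : ZdPlaquette 4 → Fin D → ℝ` with integrable coordinates, satisfying the trigonometric Stein
identity (T3) along exact directions `dα = plaquetteCurl α`:
`E[cos⟨Y,h⟩_S ⟨Y,dα⟩_S] = -⟨dα,h⟩_S E[sin⟨Y,h⟩_S]` and
`E[sin⟨Y,h⟩_S ⟨Y,dα⟩_S] = ⟨dα,h⟩_S E[cos⟨Y,h⟩_S]` for all finitely supported test data. Then the
characteristic functional is transported along `h ↦ h + dα` by the Gaussian law:
`E[cos⟨Y,h + dα⟩_S] = exp(-⟨dα,h⟩_S - ‖dα‖²_S / 2) E[cos⟨Y,h⟩_S]`, and the same with `sin`.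

Proof (ODE / integrating factor): with `C(t) := E[cos⟨Y, h + t dα⟩_S]`,
`Sn(t) := E[sin⟨Y, h + t dα⟩_S]`, `A := ⟨dα,h⟩_S`, `B := ‖dα‖²_S`, differentiation under the
integral sign (`hasDerivAt_integral_of_dominated_loc_of_deriv_le`, dominated by the integrable
`|⟨Y,dα⟩_S|`) and (T3) applied to `h + t dα` give `C' = -(A + tB) C`, `Sn' = -(A + tB) Sn`, so
`t ↦ exp(At + Bt²/2) C(t)` has zero derivative and is constant (`is_const_of_deriv_eq_zero`),
whence `C(1) = exp(-A - B/2) C(0)`; likewise for `Sn`.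
-/

noncomputable section

open MeasureTheory

open Literature.MathematicalPhysics.QuantumFieldTheory Literature.MathematicalPhysics.QuantumLattice
  Literature.Probability.LatticeModels

namespace Summit.QuantumFields.YangMills.Theorems.EquipartitionPinsProbe

namespace SteinFlow

variable {Ω : Type*} [MeasurableSpace Ω] {μ : Measure Ω}

/-- **Scalar linear ODE.** If `C' (t) = -(a + t b) C(t)` for all real `t`, then
`C 1 = exp(-a - b/2) C 0` (the integrating factor `exp(a t + b t²/2) C(t)` is constant). -/
theorem eq_exp_mul_of_hasDerivAt {C : ℝ → ℝ} {a b : ℝ}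
    (hC : ∀ t, HasDerivAt C (-(a + t * b) * C t) t) :
    C 1 = Real.exp (-a - b / 2) * C 0 := by
  have hE : ∀ t, HasDerivAt (fun s => Real.exp (a * s + b * (s * s) / 2))
      (Real.exp (a * t + b * (t * t) / 2) * (a + b * t)) t := fun t => by
    have h1 : HasDerivAt (fun s => a * s + b * (s * s) / 2) (a + b * t) t :=
      (((hasDerivAt_id' t).const_mul a).fun_add
        ((((hasDerivAt_id' t).fun_mul (hasDerivAt_id' t)).const_mul b).div_const 2)).congr_deriv
        (by ring)
    exact h1.exp
  have hG : ∀ t, HasDerivAt (fun s => Real.exp (a * s + b * (s * s) / 2) * C s) 0 t := fun t =>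
    ((hE t).fun_mul (hC t)).congr_deriv (by ring)
  have hconst := is_const_of_deriv_eq_zero (fun t => (hG t).differentiableAt)
    (fun t => (hG t).deriv) 1 0
  have h2 : Real.exp (a + b / 2) * C 1 = C 0 := by
    simp only [mul_one, mul_zero, zero_div, add_zero, Real.exp_zero, one_mul] at hconst
    exact hconst
  rw [← h2, ← mul_assoc, ← Real.exp_add, show -a - b / 2 + (a + b / 2) = 0 by ring, Real.exp_zero,
    one_mul]

/-- Differentiation under the integral sign:
`d/dt ∫ cos(u + t v) dμ = ∫ -sin(u + t v) v dμ` for measurable `u`, `v` with `v` integrable. -/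
theorem hasDerivAt_integral_cos [IsFiniteMeasure μ] {u v : Ω → ℝ} (hu : Measurable u)
    (hv : Measurable v) (hvi : Integrable v μ) (t : ℝ) :
    HasDerivAt (fun s => ∫ ω, Real.cos (u ω + s * v ω) ∂μ)
      (∫ ω, -Real.sin (u ω + t * v ω) * v ω ∂μ) t := by
  have key := hasDerivAt_integral_of_dominated_loc_of_deriv_le (μ := μ) (x₀ := t) (s := Set.univ)
    (F := fun s ω => Real.cos (u ω + s * v ω))
    (F' := fun s ω => -Real.sin (u ω + s * v ω) * v ω) (bound := fun ω => ‖v ω‖)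
    Filter.univ_mem ?_ ?_ ?_ ?_ hvi.norm ?_
  · exact key.2
  · exact Filter.Eventually.of_forall fun s =>
      (by fun_prop : Measurable fun ω => Real.cos (u ω + s * v ω)).aestronglyMeasurable
  · refine Integrable.mono' (integrable_const (1 : ℝ)) ?_ ?_
    · exact (by fun_prop : Measurable fun ω => Real.cos (u ω + t * v ω)).aestronglyMeasurable
    · exact Filter.Eventually.of_forall fun ω => by
        rw [Real.norm_eq_abs]
        exact Real.abs_cos_le_one _
  · exact (by fun_prop : Measurable fun ω => -Real.sin (u ω + t * v ω) * v ω).aestronglyMeasurable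
  · refine Filter.Eventually.of_forall fun ω s _ => ?_
    rw [norm_mul, norm_neg, Real.norm_eq_abs, Real.norm_eq_abs]
    exact mul_le_of_le_one_left (abs_nonneg _) (Real.abs_sin_le_one _)
  · refine Filter.Eventually.of_forall fun ω s _ => ?_
    exact ((hasDerivAt_mul_const (v ω)).const_add (u ω)).cos

/-- Differentiation under the integral sign:
`d/dt ∫ sin(u + t v) dμ = ∫ cos(u + t v) v dμ` for measurable `u`, `v` with `v` integrable. -/
theorem hasDerivAt_integral_sin [IsFiniteMeasure μ] {u v : Ω → ℝ} (hu : Measurable u)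
    (hv : Measurable v) (hvi : Integrable v μ) (t : ℝ) :
    HasDerivAt (fun s => ∫ ω, Real.sin (u ω + s * v ω) ∂μ)
      (∫ ω, Real.cos (u ω + t * v ω) * v ω ∂μ) t := by
  have key := hasDerivAt_integral_of_dominated_loc_of_deriv_le (μ := μ) (x₀ := t) (s := Set.univ)
    (F := fun s ω => Real.sin (u ω + s * v ω))
    (F' := fun s ω => Real.cos (u ω + s * v ω) * v ω) (bound := fun ω => ‖v ω‖)
    Filter.univ_mem ?_ ?_ ?_ ?_ hvi.norm ?_
  · exact key.2
  · exact Filter.Eventually.of_forall fun s =>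
      (by fun_prop : Measurable fun ω => Real.sin (u ω + s * v ω)).aestronglyMeasurable
  · refine Integrable.mono' (integrable_const (1 : ℝ)) ?_ ?_
    · exact (by fun_prop : Measurable fun ω => Real.sin (u ω + t * v ω)).aestronglyMeasurable
    · exact Filter.Eventually.of_forall fun ω => by
        rw [Real.norm_eq_abs]
        exact Real.abs_sin_le_one _
  · exact (by fun_prop : Measurable fun ω => Real.cos (u ω + t * v ω) * v ω).aestronglyMeasurable
  · refine Filter.Eventually.of_forall fun ω s _ => ?_
    rw [norm_mul, Real.norm_eq_abs, Real.norm_eq_abs]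
    exact mul_le_of_le_one_left (abs_nonneg _) (Real.abs_cos_le_one _)
  · refine Filter.Eventually.of_forall fun ω s _ => ?_
    exact ((hasDerivAt_mul_const (v ω)).const_add (u ω)).sin

/-- **Stein flow, abstract form.** If a finite measure `μ` satisfies the trigonometric Stein
identities `∫ cos(u + t v) v = -(a + t b) ∫ sin(u + t v)` and
`∫ sin(u + t v) v = (a + t b) ∫ cos(u + t v)` for all real `t`, then
`∫ cos(u + v) = exp(-a - b/2) ∫ cos u` and `∫ sin(u + v) = exp(-a - b/2) ∫ sin u`. -/
theorem flow [IsFiniteMeasure μ] {u v : Ω → ℝ} (hu : Measurable u) (hv : Measurable v)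
    (hvi : Integrable v μ) {a b : ℝ}
    (hcos : ∀ t : ℝ, ∫ ω, Real.cos (u ω + t * v ω) * v ω ∂μ =
      -(a + t * b) * ∫ ω, Real.sin (u ω + t * v ω) ∂μ)
    (hsin : ∀ t : ℝ, ∫ ω, Real.sin (u ω + t * v ω) * v ω ∂μ =
      (a + t * b) * ∫ ω, Real.cos (u ω + t * v ω) ∂μ) :
    (∫ ω, Real.cos (u ω + v ω) ∂μ = Real.exp (-a - b / 2) * ∫ ω, Real.cos (u ω) ∂μ) ∧
    (∫ ω, Real.sin (u ω + v ω) ∂μ = Real.exp (-a - b / 2) * ∫ ω, Real.sin (u ω) ∂μ) := by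
  have hC : ∀ t, HasDerivAt (fun s => ∫ ω, Real.cos (u ω + s * v ω) ∂μ)
      (-(a + t * b) * ∫ ω, Real.cos (u ω + t * v ω) ∂μ) t := by
    intro t
    have h := hasDerivAt_integral_cos hu hv hvi t
    have e : (∫ ω, -Real.sin (u ω + t * v ω) * v ω ∂μ) =
        -(a + t * b) * ∫ ω, Real.cos (u ω + t * v ω) ∂μ := by
      simp_rw [neg_mul, integral_neg, hsin t]
    rwa [e] at h
  have hS : ∀ t, HasDerivAt (fun s => ∫ ω, Real.sin (u ω + s * v ω) ∂μ)
      (-(a + t * b) * ∫ ω, Real.sin (u ω + t * v ω) ∂μ) t := by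
    intro t
    have h := hasDerivAt_integral_sin hu hv hvi t
    rwa [hcos t] at h
  have e1 := eq_exp_mul_of_hasDerivAt hC
  have e2 := eq_exp_mul_of_hasDerivAt hS
  simp only [one_mul, zero_mul, add_zero] at e1 e2
  exact ⟨e1, e2⟩

/-- Bilinearity of the finite pairing in the test function:
`⟨Y, h + t g⟩_S = ⟨Y, h⟩_S + t ⟨Y, g⟩_S`. -/
theorem sum_add_mul_pairing {ι : Type*} {D : ℕ} (S : Finset ι) (h g Y : ι → Fin D → ℝ) (t : ℝ) :
    ∑ p ∈ S, ∑ a : Fin D, (h p a + t * g p a) * Y p a =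
      (∑ p ∈ S, ∑ a : Fin D, h p a * Y p a) + t * ∑ p ∈ S, ∑ a : Fin D, g p a * Y p a := by
  rw [Finset.mul_sum, ← Finset.sum_add_distrib]
  refine Finset.sum_congr rfl fun p _ => ?_
  rw [Finset.mul_sum, ← Finset.sum_add_distrib]
  exact Finset.sum_congr rfl fun a _ => by ring

/-- `⟨g, h + t g⟩_S = ⟨g, h⟩_S + t ‖g‖²_S`. -/
theorem sum_mul_add_pairing {ι : Type*} {D : ℕ} (S : Finset ι) (h g : ι → Fin D → ℝ) (t : ℝ) :
    ∑ p ∈ S, ∑ a : Fin D, g p a * (h p a + t * g p a) =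
      (∑ p ∈ S, ∑ a : Fin D, g p a * h p a) + t * ∑ p ∈ S, ∑ a : Fin D, (g p a) ^ 2 := by
  rw [Finset.mul_sum, ← Finset.sum_add_distrib]
  refine Finset.sum_congr rfl fun p _ => ?_
  rw [Finset.mul_sum, ← Finset.sum_add_distrib]
  exact Finset.sum_congr rfl fun a _ => by ring

/-- Measurability of the double evaluation `Y ↦ Y p a` on `ι → Fin D → ℝ`. -/
theorem measurable_pi_apply_apply {ι : Type*} {D : ℕ} (p : ι) (a : Fin D) :
    Measurable fun Y : ι → Fin D → ℝ => Y p a :=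
  (measurable_pi_apply a).comp (measurable_pi_apply p)

/-- Measurability of the finite pairing `Y ↦ ⟨Y, h⟩_S = ∑_{p ∈ S} ∑_a h p a * Y p a`. -/
theorem measurable_pairing {ι : Type*} {D : ℕ} (S : Finset ι) (h : ι → Fin D → ℝ) :
    Measurable fun Y : ι → Fin D → ℝ => ∑ p ∈ S, ∑ a : Fin D, h p a * Y p a :=
  Finset.measurable_sum S fun p _ => Finset.measurable_sum Finset.univ fun a _ =>
    (measurable_pi_apply_apply p a).const_mul (h p a)

/-- Integrability of the finite pairing `Y ↦ ⟨Y, g⟩_S` when all coordinates are integrable. -/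
theorem integrable_pairing {ι : Type*} {D : ℕ} {τ : Measure (ι → Fin D → ℝ)}
    (hint : ∀ (p : ι) (a : Fin D), Integrable (fun Y : ι → Fin D → ℝ => Y p a) τ)
    (S : Finset ι) (g : ι → Fin D → ℝ) :
    Integrable (fun Y : ι → Fin D → ℝ => ∑ p ∈ S, ∑ a : Fin D, g p a * Y p a) τ :=
  integrable_finsetSum S fun p _ => integrable_finsetSum Finset.univ fun a _ =>
    (hint p a).const_mul (g p a)

/-- **Stein flow on cochains.** For a finite measure `τ` on `ι → Fin D → ℝ` with integrable
coordinates, the trigonometric Stein identities along the segment `h + t g` (`t ∈ ℝ`) imply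
`E[cos⟨Y, h + g⟩_S] = exp(-⟨g,h⟩_S - ‖g‖²_S/2) E[cos⟨Y,h⟩_S]` and the same with `sin`. -/
theorem flow_of_stein {ι : Type*} {D : ℕ} (τ : Measure (ι → Fin D → ℝ)) [IsFiniteMeasure τ]
    (hint : ∀ (p : ι) (a : Fin D), Integrable (fun Y : ι → Fin D → ℝ => Y p a) τ)
    (S : Finset ι) (h g : ι → Fin D → ℝ)
    (hT3 : ∀ t : ℝ,
      (∫ Y, Real.cos (∑ p ∈ S, ∑ a : Fin D, (h p a + t * g p a) * Y p a) *
            (∑ p ∈ S, ∑ a : Fin D, g p a * Y p a) ∂τ =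
          -(∑ p ∈ S, ∑ a : Fin D, g p a * (h p a + t * g p a)) *
            ∫ Y, Real.sin (∑ p ∈ S, ∑ a : Fin D, (h p a + t * g p a) * Y p a) ∂τ) ∧
        (∫ Y, Real.sin (∑ p ∈ S, ∑ a : Fin D, (h p a + t * g p a) * Y p a) *
            (∑ p ∈ S, ∑ a : Fin D, g p a * Y p a) ∂τ =
          (∑ p ∈ S, ∑ a : Fin D, g p a * (h p a + t * g p a)) *
            ∫ Y, Real.cos (∑ p ∈ S, ∑ a : Fin D, (h p a + t * g p a) * Y p a) ∂τ)) :
    (∫ Y, Real.cos (∑ p ∈ S, ∑ a : Fin D, (h p a + g p a) * Y p a) ∂τ =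
        Real.exp (-(∑ p ∈ S, ∑ a : Fin D, g p a * h p a) -
            (∑ p ∈ S, ∑ a : Fin D, (g p a) ^ 2) / 2) *
          ∫ Y, Real.cos (∑ p ∈ S, ∑ a : Fin D, h p a * Y p a) ∂τ) ∧
      (∫ Y, Real.sin (∑ p ∈ S, ∑ a : Fin D, (h p a + g p a) * Y p a) ∂τ =
        Real.exp (-(∑ p ∈ S, ∑ a : Fin D, g p a * h p a) -
            (∑ p ∈ S, ∑ a : Fin D, (g p a) ^ 2) / 2) *
          ∫ Y, Real.sin (∑ p ∈ S, ∑ a : Fin D, h p a * Y p a) ∂τ) := by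
  have e1 : ∀ Y : ι → Fin D → ℝ, ∑ p ∈ S, ∑ a : Fin D, (h p a + g p a) * Y p a =
      (∑ p ∈ S, ∑ a : Fin D, h p a * Y p a) + ∑ p ∈ S, ∑ a : Fin D, g p a * Y p a := fun Y => by
    simpa only [one_mul] using sum_add_mul_pairing S h g Y 1
  simp only [e1]
  refine flow (μ := τ) (u := fun Y => ∑ p ∈ S, ∑ a : Fin D, h p a * Y p a)
    (v := fun Y => ∑ p ∈ S, ∑ a : Fin D, g p a * Y p a) (measurable_pairing S h)
    (measurable_pairing S g) (integrable_pairing hint S g) (fun t => ?_) (fun t => ?_)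
  · have key := (hT3 t).1
    simp only [sum_add_mul_pairing, sum_mul_add_pairing] at key
    exact key
  · have key := (hT3 t).2
    simp only [sum_add_mul_pairing, sum_mul_add_pairing] at key
    exact key

end SteinFlow

/-- STUB R1 — **Stein flow**: for a probability measure `τ` on `ℝ^D`-valued `2`-cochains of `ℤ⁴`
with integrable coordinates, the trigonometric Stein identity (T3) along exact directions
`dα = plaquetteCurl α` transports the characteristic functional along `h ↦ h + dα` by the
Gaussian law: `E[cos⟨Y, h + dα⟩_S] = exp(-⟨dα,h⟩_S - ‖dα‖²_S/2) E[cos⟨Y,h⟩_S]`, and the same with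
`sin` (`SteinFlow.flow_of_stein`, fed with (T3) applied to `h + t dα`, whose support hypotheses
do not depend on `t`). -/
theorem stub_steinFlow :
    ∀ (D : ℕ) (τ : MeasureTheory.Measure
        (Literature.MathematicalPhysics.QuantumLattice.ZdPlaquette 4 → Fin D → ℝ)),
      MeasureTheory.IsProbabilityMeasure τ →
      (∀ (p : Literature.MathematicalPhysics.QuantumLattice.ZdPlaquette 4) (a : Fin D),
        MeasureTheory.Integrable (fun Y : Literature.MathematicalPhysics.QuantumLattice.ZdPlaquette 4 → Fin D → ℝ => Y p a) τ) →
      (∀ (S : Finset (Literature.MathematicalPhysics.QuantumLattice.ZdPlaquette 4))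
          (E : Finset (Literature.MathematicalPhysics.QuantumLattice.ZdEdge 4))
          (h : Literature.MathematicalPhysics.QuantumLattice.ZdPlaquette 4 → Fin D → ℝ)
          (α : Literature.MathematicalPhysics.QuantumLattice.ZdEdge 4 → Fin D → ℝ),
        (∀ e, e ∉ E → α e = 0) →
        (∀ p, p ∉ S → ∀ a : Fin D,
          Literature.MathematicalPhysics.QuantumFieldTheory.plaquetteCurl (fun e => α e a) p = 0) →
        (∫ Y, Real.cos (∑ p ∈ S, ∑ a : Fin D, h p a * Y p a) *
            (∑ p ∈ S, ∑ a : Fin D,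
              Literature.MathematicalPhysics.QuantumFieldTheory.plaquetteCurl
                (fun e => α e a) p * Y p a) ∂τ =
          -(∑ p ∈ S, ∑ a : Fin D,
              Literature.MathematicalPhysics.QuantumFieldTheory.plaquetteCurl
                (fun e => α e a) p * h p a) *
            ∫ Y, Real.sin (∑ p ∈ S, ∑ a : Fin D, h p a * Y p a) ∂τ) ∧
        (∫ Y, Real.sin (∑ p ∈ S, ∑ a : Fin D, h p a * Y p a) *
            (∑ p ∈ S, ∑ a : Fin D,
              Literature.MathematicalPhysics.QuantumFieldTheory.plaquetteCurl
                (fun e => α e a) p * Y p a) ∂τ =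
          (∑ p ∈ S, ∑ a : Fin D,
              Literature.MathematicalPhysics.QuantumFieldTheory.plaquetteCurl
                (fun e => α e a) p * h p a) *
            ∫ Y, Real.cos (∑ p ∈ S, ∑ a : Fin D, h p a * Y p a) ∂τ)) →
      ∀ (S : Finset (Literature.MathematicalPhysics.QuantumLattice.ZdPlaquette 4))
          (E : Finset (Literature.MathematicalPhysics.QuantumLattice.ZdEdge 4))
          (h : Literature.MathematicalPhysics.QuantumLattice.ZdPlaquette 4 → Fin D → ℝ)
          (α : Literature.MathematicalPhysics.QuantumLattice.ZdEdge 4 → Fin D → ℝ),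
        (∀ e, e ∉ E → α e = 0) →
        (∀ p, p ∉ S → ∀ a : Fin D,
          Literature.MathematicalPhysics.QuantumFieldTheory.plaquetteCurl (fun e => α e a) p = 0) →
        (∫ Y, Real.cos (∑ p ∈ S, ∑ a : Fin D,
            (h p a + Literature.MathematicalPhysics.QuantumFieldTheory.plaquetteCurl (fun e => α e a) p) * Y p a) ∂τ =
          Real.exp (-(∑ p ∈ S, ∑ a : Fin D,
                Literature.MathematicalPhysics.QuantumFieldTheory.plaquetteCurl (fun e => α e a) p * h p a) -
              (∑ p ∈ S, ∑ a : Fin D,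
                (Literature.MathematicalPhysics.QuantumFieldTheory.plaquetteCurl (fun e => α e a) p) ^ 2) / 2) *
            ∫ Y, Real.cos (∑ p ∈ S, ∑ a : Fin D, h p a * Y p a) ∂τ) ∧
        (∫ Y, Real.sin (∑ p ∈ S, ∑ a : Fin D,
            (h p a + Literature.MathematicalPhysics.QuantumFieldTheory.plaquetteCurl (fun e => α e a) p) * Y p a) ∂τ =
          Real.exp (-(∑ p ∈ S, ∑ a : Fin D,
                Literature.MathematicalPhysics.QuantumFieldTheory.plaquetteCurl (fun e => α e a) p * h p a) -
              (∑ p ∈ S, ∑ a : Fin D,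
                (Literature.MathematicalPhysics.QuantumFieldTheory.plaquetteCurl (fun e => α e a) p) ^ 2) / 2) *
            ∫ Y, Real.sin (∑ p ∈ S, ∑ a : Fin D, h p a * Y p a) ∂τ) := by
  intro D τ hτ hint hT3 S E h α hαE hαS
  exact SteinFlow.flow_of_stein τ hint S h (fun p a => plaquetteCurl (fun e => α e a) p)
    (fun t => hT3 S E (fun p a => h p a + t * plaquetteCurl (fun e => α e a) p) α hαE hαS)

end Summit.QuantumFields.YangMills.Theorems.EquipartitionPinsProbe

end
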